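import Summits.HodgeConjecture.HodgeConjecture.Theorems.F0P3GKModuleConjVec   -- B6a (this seat): conjugate (𝔤,K)-modules
import Literature.NumberTheory.Automorphic.DiscreteAutomorphicRepArchIsotypy
import Literature.NumberTheory.Automorphic.UnitaryGroupCotangentSpectralProjectionConj
import Literature.NumberTheory.Automorphic.DiscreteAutomorphicRepArchModuleCM
import HarnessLib

/-!
# Crux `H413` — RUNG 1½ «ISOTYPY FROM A NULL CORE», brick B6: the letter F1a is INVARIANT UNDER COMPLEX CONJUGATION `P ↦ P̄`,
# and the CM stub `StubF1aCM` (hol ∨ antihol) follows from its HOLOMORPHIC half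

Floor-0 programme P3 «U3-mult», seat F0P3-p01 (g4); crux item stmt-HodgeConjecture-24833 (`HCCMUnconditional.H413`); rung-1 line
`Cruxes/H413/Lines/F0_U3LettersRung1.lean` ed. 2, stub `stub_F1a_cm : StubF1aCM` (v3 text: F1a ★ `DiscreteAutomorphicRep.ArchIsotypy` at the CM frame for
every discrete `P` of Hodge type `(1,0)` OR `(0,1)`); road «F1a in-house at the pin» (F0P3-p02 (g3)) proves the `(1,0)` half (B1–B5 + ★ B5b
`F0P3ArchIsotypyOfIrreducibleCore`).  THIS FILE: the `(0,1)` half is the `(1,0)` half applied to the complex conjugate `P̄`.  HC_CM is proved only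
modulo the printed citations until rung 0 closes.

THE MATHEMATICS ([BorelJacquetCorvallis1979, §4.6]; [Clozel1990, §3.1] `^cπ`; [BorelWallach2000, VII 2.10]).  Complex conjugation `f ↦ f̄` is a
conjugate-linear isometry of `L²(G(𝔸) ⧸ A_G G(K))` commuting with right translations (★ `AutomorphicConjugate`: `conjL2`, `rightRegular_conjL2`,
`ClosedSubrep.conjEquiv`); it carries a discrete automorphic `P` onto `P̄` (★ `DiscreteAutomorphicRep.conj`), smooth vectors of `P|_G` onto smooth
vectors of `P̄|_G`, `K`-finite vectors onto `K`-finite vectors, hence the archimedean `(𝔤, K)`-module `P.archModule G ιG` conjugate-linearly onto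
`P̄.archModule G ιG`, intertwining `K` and commuting with the differential (`\overline{X·f} = X·f̄`: uniqueness of derivatives).  So if the
`(𝔤, K)`-maps `P̄.archModule → M` into ONE irreducible admissible `M` separate vectors (letter F1a for `P̄`), then the conjugate-linear composites
`P.archModule → P̄.archModule → M`, read as COMPLEX-linear maps into the conjugate module `M̄ = ConjVec M` (irreducible admissible, ★
`F0P3GKModuleConjVec`), separate the vectors of `P.archModule`: letter F1a for `P`.

* §1 `L²`-level transport: `star` preserves the smoothness and `K`-finiteness conditions of ★ `mem_archModule_iff_coe`
  (`contDiff_rightRegular_star`, `finiteDimensional_span_rightRegular_star`), hence `conjEquiv_mem_archModule` (+ `_iff`); the conjugate vector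
  `⟨f̄⟩ ∈ P̄.archModule` of `f ∈ P.archModule` is `K`-equivariant (`conj_archRepK`) and commutes with the derived action (`coe_dπ_conj`, `conj_archRepLie`).
* §2 HEAD `archIsotypy_of_conj : P.conj.ArchIsotypy G ιG → P.ArchIsotypy G ιG` and `archIsotypy_conj_iff` (generic `𝒢, G, ιG`).
* §3 CM FOLDS: pointwise `archIsotypy_cm_of_hol_half` (fixed CM datum: hol half for all `P′` ⇒ hol-or-antihol `P`; robust to extra outer binders
  such as `hdef`∕`h2`) and `stubF1aCM_of_hol` — `(∀ hol-type P, F1a at the CM frame) → <StubF1aCM v3 text VERBATIM>` (the antihol disjunct through ★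
  `isAntiholCotangentAt_iff_conj` and §2): the road's CM assembly needs the `(1,0)` case only.

No definition, no `sorry`, no named fact; `--supports stmt-HodgeConjecture-24833`.  [cite: BorelJacquetCorvallis1979, §4.3 and §4.6]
[cite: Clozel1990, §3.1] [cite: BorelWallach2000, 0 §2.4–2.5; VII 2.10] [cite: KnappVogan1995, §VI.2] [cite: FlathCorvallis1979, Thm. 3 and Thm. 4]
-/

set_option autoImplicit false
-- the mandated namespace repeats `HodgeConjecture.HodgeConjecture`, as in every `Theorems/*.lean` of this sub-problem
set_option linter.dupNamespace false

-- Mathlib idiom (Mathlib/Algebra/Lie/OfAssociative.lean; as in ★ `GKModules`): the commutator bracket on `Module.End ℂ V`,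
-- needed to MENTION `G.lie →ₗ⁅ℝ⁆ Module.End ℂ _`.
attribute [local instance 100] LieRing.ofAssociativeRing

open MeasureTheory NumberField
open scoped InnerProductSpace Matrix.Norms.Operator ContDiff Matrix

universe u

namespace Summit.HodgeConjecture.HodgeConjecture.Cruxes.H413.F0P3ArchIsotypyConj

open Literature.NumberTheory.Automorphic Literature.NumberTheory.Automorphic.ConjVec
open Summit.HodgeConjecture.HodgeConjecture.Cruxes.H413.F0P3GKModuleConjVec

/-! ## §1 Complex conjugation on `L²` and the archimedean module -/

section L2

variable {K : Type} [Field K] [NumberField K] {𝒢 : AdelicGroupData.{u} K}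
  {μ : Measure 𝒢.automorphicQuotient} [𝒢.IsAutomorphicMeasure μ]
  {A : Type*} [NormedCommRing A] [NormedAlgebra ℝ A] [NormedAlgebra ℚ A] [CompleteSpace A]
  [StarRing A] {N : Type*} [Fintype N] [DecidableEq N]
  (P : DiscreteAutomorphicRep 𝒢 μ) (G : RealMatrixGroup A N) (ιG : G.carrier →* 𝒢.Adelic)

omit [𝒢.IsAutomorphicMeasure μ] in
/-- `star (r • f) = r • star f` in `L²` for REAL `r`. [folklore] -/
theorem L2_star_real_smul (r : ℝ) (f : 𝒢.L2 μ) : star (r • f) = r • star f := by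
  rw [RCLike.real_smul_eq_coe_smul (K := ℂ) r f, AdelicGroupData.L2.star_smul, RCLike.conj_ofReal,
    ← RCLike.real_smul_eq_coe_smul (K := ℂ)]

omit [𝒢.IsAutomorphicMeasure μ] in
/-- **Complex conjugation on `L²` as a REAL-linear continuous map** (an `∃`-packaging, no definition): there is `c : L² →L[ℝ] L²` with
`c f = star f`. [folklore] -/
theorem exists_starCLM_real : ∃ c : 𝒢.L2 μ →L[ℝ] 𝒢.L2 μ, ∀ f, c f = star f :=
  ⟨{ toFun := star
     map_add' := AdelicGroupData.L2.star_add 𝒢 μ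
     map_smul' := fun r f => L2_star_real_smul r f
     cont := (𝒢.conjL2 μ).continuous }, fun _ => rfl⟩

/-- **Smoothness along `ιG` is preserved by conjugation**: `X ↦ R(ιG (exp X)) f̄ = \overline{X ↦ R(ιG (exp X)) f}`.
[cite: BorelJacquetCorvallis1979, §4.6] -/
theorem contDiff_rightRegular_star {f : 𝒢.L2 μ}
    (hf : ContDiff ℝ ∞ fun X : G.lie.toSubmodule => 𝒢.rightRegular μ (ιG (G.expMem ⟨X, X.2⟩)) f) :
    ContDiff ℝ ∞ fun X : G.lie.toSubmodule => 𝒢.rightRegular μ (ιG (G.expMem ⟨X, X.2⟩)) (star f) := by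
  obtain ⟨c, hc⟩ := exists_starCLM_real (𝒢 := 𝒢) (μ := μ)
  have h : (fun X : G.lie.toSubmodule => 𝒢.rightRegular μ (ιG (G.expMem ⟨X, X.2⟩)) (star f)) =
      fun X : G.lie.toSubmodule => c (𝒢.rightRegular μ (ιG (G.expMem ⟨X, X.2⟩)) f) := by
    funext X
    rw [hc, ← AdelicGroupData.conjL2_apply, ← AdelicGroupData.conjL2_apply, AdelicGroupData.rightRegular_conjL2]
  rw [h]
  exact c.contDiff.comp hf

/-- The `K`-orbit of `f̄` in `L²` is the conjugate of the `K`-orbit of `f`. [cite: BorelJacquetCorvallis1979, §4.6] -/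
theorem range_rightRegular_star (f : 𝒢.L2 μ) :
    (Set.range fun k : G.maximalCompact =>
        𝒢.rightRegular μ (ιG (Subgroup.inclusion G.maximalCompact_le_carrier k)) (star f)) =
      (𝒢.conjL2 μ).toLinearEquiv '' Set.range fun k : G.maximalCompact =>
        𝒢.rightRegular μ (ιG (Subgroup.inclusion G.maximalCompact_le_carrier k)) f := by
  ext x
  simp only [Set.mem_range, Set.mem_image, exists_exists_eq_and]
  constructor
  · rintro ⟨k, rfl⟩
    exact ⟨k, by rw [LinearIsometryEquiv.coe_toLinearEquiv, ← AdelicGroupData.rightRegular_conjL2,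
      AdelicGroupData.conjL2_apply]⟩
  · rintro ⟨k, rfl⟩
    exact ⟨k, by rw [LinearIsometryEquiv.coe_toLinearEquiv, ← AdelicGroupData.rightRegular_conjL2,
      AdelicGroupData.conjL2_apply]⟩

/-- **`K`-finiteness is preserved by conjugation.** [cite: BorelWallach2000, 0 §2.4] -/
theorem finiteDimensional_span_rightRegular_star {f : 𝒢.L2 μ}
    (hf : FiniteDimensional ℂ (Submodule.span ℂ (Set.range fun k : G.maximalCompact =>
        𝒢.rightRegular μ (ιG (Subgroup.inclusion G.maximalCompact_le_carrier k)) f))) :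
    FiniteDimensional ℂ (Submodule.span ℂ (Set.range fun k : G.maximalCompact =>
        𝒢.rightRegular μ (ιG (Subgroup.inclusion G.maximalCompact_le_carrier k)) (star f))) := by
  rw [range_rightRegular_star G ιG f]
  exact finiteDimensional_span_image_of_conjSemilinear (𝒢.conjL2 μ).toLinearEquiv _

/-- **`f ∈ P.archModule ⇒ f̄ ∈ P̄.archModule`** for every `w ∈ P̄` with `w = f̄` in `L²` (smoothness and `K`-finiteness read in `L²`, ★
`mem_archModule_iff_coe`). [cite: BorelJacquetCorvallis1979, §4.3 and §4.6] [cite: BorelWallach2000, 0 §2.4] -/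
theorem mem_archModule_conj_of_coe_eq_star {v : P.space.toSubmodule} (hv : v ∈ P.archModule G ιG)
    {w : P.conj.space.toSubmodule} (hw : (w : 𝒢.L2 μ) = star (v : 𝒢.L2 μ)) : w ∈ P.conj.archModule G ιG := by
  have h := (DiscreteAutomorphicRep.mem_archModule_iff_coe P G ιG v).mp hv
  refine (DiscreteAutomorphicRep.mem_archModule_iff_coe P.conj G ιG w).mpr ?_
  rw [hw]
  exact ⟨contDiff_rightRegular_star G ιG h.1, finiteDimensional_span_rightRegular_star G ιG h.2⟩

/-- In particular `⟨f̄⟩ ∈ P̄.archModule` for `f ∈ P.archModule` (★ `DiscreteAutomorphicRep.star_mem_conj_space`). [cite: BorelJacquetCorvallis1979, §4.6] -/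
theorem star_mem_archModule (v : P.archModule G ιG) :
    (⟨star ((v : P.space.toSubmodule) : 𝒢.L2 μ), P.star_mem_conj_space (v : P.space.toSubmodule).2⟩ :
      P.conj.space.toSubmodule) ∈ P.conj.archModule G ιG :=
  mem_archModule_conj_of_coe_eq_star P G ιG v.2 rfl

/-- **Conjugation intertwines the `K`-actions** on the archimedean modules of `P` and `P̄`, read in `L²` (`R(ιG k) f̄ = \overline{R(ιG k) f}`).
[cite: BorelJacquetCorvallis1979, §4.6] -/
theorem coe_archRepK_conj {v : P.archModule G ιG} {w : P.conj.archModule G ιG}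
    (hw : ((w : P.conj.space.toSubmodule) : 𝒢.L2 μ) = star ((v : P.space.toSubmodule) : 𝒢.L2 μ)) (k : G.maximalCompact) :
    (((P.conj.archRepK G ιG k w : P.conj.archModule G ιG) : P.conj.space.toSubmodule) : 𝒢.L2 μ) =
      star (((P.archRepK G ιG k v : P.archModule G ιG) : P.space.toSubmodule) : 𝒢.L2 μ) := by
  rw [DiscreteAutomorphicRep.coe_archRepK_apply, DiscreteAutomorphicRep.coe_archRep_apply,
    DiscreteAutomorphicRep.coe_archRepK_apply, DiscreteAutomorphicRep.coe_archRep_apply, hw,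
    ← AdelicGroupData.conjL2_apply, ← AdelicGroupData.conjL2_apply, AdelicGroupData.rightRegular_conjL2]

/-- **Conjugation commutes with the differential**: `dP̄(X) f̄ = \overline{dP(X) f}` in `L²` for `f` smooth (both sides are the derivative at
`t = 0` of `t ↦ R(ιG (exp tX)) f̄ = \overline{R(ιG (exp tX)) f}`; ★ `hasDerivAt_dπ`, uniqueness of derivatives). [cite: BorelWallach2000, 0 §2.4]
[cite: Clozel1990, §3.1] -/
theorem coe_dπ_conj {v : P.space.toSubmodule} (hv : v ∈ smoothVectors G (P.archRep G ιG))
    {w : P.conj.space.toSubmodule} (hw : (w : 𝒢.L2 μ) = star (v : 𝒢.L2 μ)) (X : G.lie) :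
    ((dπ G (P.conj.archRep G ιG) w X : P.conj.space.toSubmodule) : 𝒢.L2 μ) =
      star ((dπ G (P.archRep G ιG) v X : P.space.toSubmodule) : 𝒢.L2 μ) := by
  obtain ⟨c, hc⟩ := exists_starCLM_real (𝒢 := 𝒢) (μ := μ)
  -- smoothness of the conjugate vector
  have hw' : w ∈ smoothVectors G (P.conj.archRep G ιG) := by
    refine (DiscreteAutomorphicRep.mem_smoothVectors_archRep_iff P.conj G ιG w).mpr ?_
    rw [hw]
    exact contDiff_rightRegular_star G ιG ((DiscreteAutomorphicRep.mem_smoothVectors_archRep_iff P G ιG v).mp hv)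
  -- derivative of the conjugate orbit, read in `L²`
  have h1 : HasDerivAt (fun t : ℝ => (((P.conj.archRep G ιG) (G.expMem (t • X)) w : P.conj.space.toSubmodule) : 𝒢.L2 μ))
      ((dπ G (P.conj.archRep G ιG) w X : P.conj.space.toSubmodule) : 𝒢.L2 μ) 0 :=
    ((P.conj.space.toSubmodule.subtypeL).restrictScalars ℝ).hasFDerivAt.comp_hasDerivAt (0 : ℝ)
      (hasDerivAt_dπ G (P.conj.archRep G ιG) (differentiableAt_of_mem_smoothVectors G _ hw') X)
  -- conjugate of the derivative of the orbit, read in `L²`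
  have h2 : HasDerivAt (fun t : ℝ => c (((P.archRep G ιG) (G.expMem (t • X)) v : P.space.toSubmodule) : 𝒢.L2 μ))
      (c ((dπ G (P.archRep G ιG) v X : P.space.toSubmodule) : 𝒢.L2 μ)) 0 :=
    c.hasFDerivAt.comp_hasDerivAt (0 : ℝ)
      (((P.space.toSubmodule.subtypeL).restrictScalars ℝ).hasFDerivAt.comp_hasDerivAt (0 : ℝ)
        (hasDerivAt_dπ G (P.archRep G ιG) (differentiableAt_of_mem_smoothVectors G _ hv) X))
  have hfun : (fun t : ℝ => (((P.conj.archRep G ιG) (G.expMem (t • X)) w : P.conj.space.toSubmodule) : 𝒢.L2 μ)) =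
      fun t : ℝ => c (((P.archRep G ιG) (G.expMem (t • X)) v : P.space.toSubmodule) : 𝒢.L2 μ) := by
    funext t
    rw [hc, DiscreteAutomorphicRep.coe_archRep_apply, DiscreteAutomorphicRep.coe_archRep_apply, hw,
      ← AdelicGroupData.conjL2_apply, ← AdelicGroupData.conjL2_apply, AdelicGroupData.rightRegular_conjL2]
  rw [hfun] at h1
  rw [← hc]
  exact h1.unique h2

variable [FiniteDimensional ℝ A] (hι : Continuous ιG)

/-- **Conjugation intertwines the derived `𝔤`-actions** on the archimedean modules of `P` and `P̄`, read in `L²`. [cite: BorelWallach2000, 0 §2.4]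
[cite: Clozel1990, §3.1] -/
theorem coe_archRepLie_conj {v : P.archModule G ιG} {w : P.conj.archModule G ιG}
    (hw : ((w : P.conj.space.toSubmodule) : 𝒢.L2 μ) = star ((v : P.space.toSubmodule) : 𝒢.L2 μ)) (X : G.lie) :
    (((P.conj.archRepLie G ιG hι X w : P.conj.archModule G ιG) : P.conj.space.toSubmodule) : 𝒢.L2 μ) =
      star (((P.archRepLie G ιG hι X v : P.archModule G ιG) : P.space.toSubmodule) : 𝒢.L2 μ) := by
  rw [DiscreteAutomorphicRep.coe_archRepLie_apply, DiscreteAutomorphicRep.coe_archRepLie_apply]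
  exact coe_dπ_conj P G ιG v.2.1 hw X

end L2

/-! ## §2 HEAD — the letter F1a is invariant under `P ↦ P̄` -/

section Head

variable {K : Type} [Field K] [NumberField K] {𝒢 : AdelicGroupData.{0} K}
  {μ : Measure 𝒢.automorphicQuotient} [𝒢.IsAutomorphicMeasure μ]
  {A : Type*} [NormedCommRing A] [NormedAlgebra ℝ A] [NormedAlgebra ℚ A] [CompleteSpace A]
  [StarRing A] {N : Type*} [Fintype N] [DecidableEq N]
  (P : DiscreteAutomorphicRep 𝒢 μ) (G : RealMatrixGroup A N) (ιG : G.carrier →* 𝒢.Adelic)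

/-- **HEAD — `F1a(P̄) ⇒ F1a(P)`.**  If the `(𝔤, K)`-maps from `P̄.archModule G ιG` into one irreducible admissible `(𝔤, K)`-module `M` separate
vectors, then the `(𝔤, K)`-maps from `P.archModule G ιG` into the conjugate module `M̄ = ConjVec M` (irreducible admissible, ★ `F0P3GKModuleConjVec`)
separate vectors: `v ↦ toConj (φ ⟨v̄⟩)`. [cite: Clozel1990, §3.1] [cite: BorelJacquetCorvallis1979, §4.6] [cite: FlathCorvallis1979, Thm. 3 and Thm. 4] -/
theorem archIsotypy_of_conj (h : P.conj.ArchIsotypy G ιG) : P.ArchIsotypy G ιG := by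
  intro _ _ _ hA hG hι hfac
  obtain ⟨M, _, _, σK, σ𝔤, hGK, hirr, hadm, hsep⟩ := h hA hG hι hfac
  refine ⟨ConjVec M, inferInstance, inferInstance, repConj σK, conjRep σ𝔤, isGKModule_repConj G hGK,
    isIrreducibleGK_repConj G hirr, isAdmissibleGK_repConj G hadm, fun v hv => ?_⟩
  -- the conjugation map `P.archModule → P̄.archModule`, `u ↦ ⟨ū⟩`
  let cj : P.archModule G ιG → P.conj.archModule G ιG := fun u =>
    ⟨⟨star ((u : P.space.toSubmodule) : 𝒢.L2 μ), P.star_mem_conj_space (u : P.space.toSubmodule).2⟩,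
      star_mem_archModule P G ιG u⟩
  have hcj : ∀ u : P.archModule G ιG,
      (((cj u : P.conj.archModule G ιG) : P.conj.space.toSubmodule) : 𝒢.L2 μ) = star ((u : P.space.toSubmodule) : 𝒢.L2 μ) :=
    fun u => rfl
  have hcj_add : ∀ u u' : P.archModule G ιG, cj (u + u') = cj u + cj u' := fun u u' => by
    apply Subtype.ext
    apply Subtype.ext
    rw [hcj]
    change star (((u : P.space.toSubmodule) : 𝒢.L2 μ) + ((u' : P.space.toSubmodule) : 𝒢.L2 μ)) =
      star ((u : P.space.toSubmodule) : 𝒢.L2 μ) + star ((u' : P.space.toSubmodule) : 𝒢.L2 μ)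
    exact AdelicGroupData.L2.star_add 𝒢 μ _ _
  have hcj_smul : ∀ (a : ℂ) (u : P.archModule G ιG), cj (a • u) = starRingEnd ℂ a • cj u := fun a u => by
    apply Subtype.ext
    apply Subtype.ext
    rw [hcj]
    change star (a • ((u : P.space.toSubmodule) : 𝒢.L2 μ)) = starRingEnd ℂ a • star ((u : P.space.toSubmodule) : 𝒢.L2 μ)
    exact AdelicGroupData.L2.star_smul 𝒢 μ a _
  have hv' : cj v ≠ 0 := by
    intro h0
    apply hv
    have h1 : star ((v : P.space.toSubmodule) : 𝒢.L2 μ) = 0 := by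
      rw [← hcj, h0]
      rfl
    have h2 : ((v : P.space.toSubmodule) : 𝒢.L2 μ) = 0 := (𝒢.conjL2 μ).map_eq_zero_iff.mp h1
    exact Subtype.ext (Subtype.ext h2)
  obtain ⟨φ, hφK, hφ𝔤, hφv⟩ := hsep (cj v) hv'
  refine ⟨{ toFun := fun u => toConj (φ (cj u))
            map_add' := fun u u' => by rw [hcj_add, map_add, map_add]
            map_smul' := fun a u => by
              rw [RingHom.id_apply, hcj_smul, map_smul, smul_toConj] },
    fun k u => ?_, fun X u => ?_, ?_⟩
  · change toConj (φ (cj (P.archRepK G ιG k u))) = repConj σK k (toConj (φ (cj u)))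
    rw [repConj_apply_toConj, ← hφK]
    congr 2
    apply Subtype.ext
    apply Subtype.ext
    rw [hcj]
    exact (coe_archRepK_conj P G ιG (hcj u) k).symm
  · change toConj (φ (cj (P.archRepLie G ιG hι X u))) = conjRep σ𝔤 X (toConj (φ (cj u)))
    rw [conjRep_apply_toConj, ← hφ𝔤]
    congr 2
    apply Subtype.ext
    apply Subtype.ext
    rw [hcj]
    exact (coe_archRepLie_conj P G ιG hι (hcj u) X).symm
  · change toConj (φ (cj v)) ≠ 0
    exact fun h0 => hφv ((toConj (V := M)).map_eq_zero_iff.mp h0)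

/-- **The letter F1a is invariant under complex conjugation**: `F1a(P̄) ↔ F1a(P)`. [cite: Clozel1990, §3.1] [cite: BorelJacquetCorvallis1979, §4.6] -/
theorem archIsotypy_conj_iff : P.conj.ArchIsotypy G ιG ↔ P.ArchIsotypy G ιG :=
  ⟨archIsotypy_of_conj P G ιG, fun h => archIsotypy_of_conj P.conj G ιG (by rw [DiscreteAutomorphicRep.conj_conj]; exact h)⟩

end Head

/-! ## §3 CM FOLD — `StubF1aCM` (hol ∨ antihol) from its holomorphic half -/

section CM

open Literature.NumberTheory.Automorphic.UnitaryGroup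
open Literature.NumberTheory.Automorphic.UnitaryGroup.CotangentForms (cmArchSection cmCompactFactor)
open Literature.RepresentationTheory.KonnoKonno2007 (uFormGroup)

/-- **Pointwise CM fold**: at a fixed CM datum `(L, ι, H, T, hT, μ)`, if F1a at the CM frame holds for every discrete `P′` of holomorphic type
`(1,0)`, then it holds for every `P` of type `(1,0)` OR `(0,1)` (the antiholomorphic `P` has holomorphic conjugate `P̄`, ★ `isAntiholCotangentAt_iff_conj`,
and F1a descends from `P̄` to `P`, §2).  Use this form when the stub carries extra outer binders (e.g. `hdef`, `h2`): they are fixed together with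
the datum. [cite: BorelWallach2000, VII 2.10] [cite: Clozel1990, §3.1] -/
theorem archIsotypy_cm_of_hol_half (L : Type) [Field L] [NumberField L] [IsCMField L] (ι : L →+* ℂ) (H : Matrix (Fin 3) (Fin 3) L)
    (T : GL (Fin 3) ℂ)
    (hT : (T : Matrix (Fin 3) (Fin 3) ℂ)ᴴ * H.map ι * (T : Matrix (Fin 3) (Fin 3) ℂ) = Literature.Geometry.ComplexHyperbolic.BallModel.J)
    (μ : Measure (adelicGroupData (↥(maximalRealSubfield L)) L (IsCMField.complexConj L) 3 H).automorphicQuotient)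
    [(adelicGroupData (↥(maximalRealSubfield L)) L (IsCMField.complexConj L) 3 H).IsAutomorphicMeasure μ]
    (hhol : ∀ P' : DiscreteAutomorphicRep (adelicGroupData (↥(maximalRealSubfield L)) L (IsCMField.complexConj L) 3 H) μ,
      P'.IsHolCotangentAt (cmArchSection L ι H T hT) (cmCompactFactor L ι H T hT) →
      P'.ArchIsotypy (uFormGroup (Fin 2) (Fin 1)) (cmArchSectionUForm L ι H T hT))
    (P : DiscreteAutomorphicRep (adelicGroupData (↥(maximalRealSubfield L)) L (IsCMField.complexConj L) 3 H) μ)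
    (hP : P.IsHolCotangentAt (cmArchSection L ι H T hT) (cmCompactFactor L ι H T hT) ∨
      P.IsAntiholCotangentAt (cmArchSection L ι H T hT) (cmCompactFactor L ι H T hT)) :
    P.ArchIsotypy (uFormGroup (Fin 2) (Fin 1)) (cmArchSectionUForm L ι H T hT) := by
  rcases hP with hP | hP
  · exact hhol P hP
  · exact archIsotypy_of_conj P (uFormGroup (Fin 2) (Fin 1)) (cmArchSectionUForm L ι H T hT)
      (hhol P.conj ((CotangentForms.isAntiholCotangentAt_iff_conj P (cmArchSection L ι H T hT) (cmCompactFactor L ι H T hT)).mp hP))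

/-- **CM FOLD `stubF1aCM_of_hol`**: the rung-1 stub `StubF1aCM` (F1a at the CM frame `(uFormGroup (Fin 2) (Fin 1), cmArchSectionUForm L ι H T hT)`
for every discrete `P` with `IsHolCotangentAt ∨ IsAntiholCotangentAt`, text of `Lines/F0_U3LettersRung1.lean` ed. 2.1 §1 VERBATIM) from its
HOLOMORPHIC HALF (the same text with the disjunction replaced by its first disjunct). [cite: BorelWallach2000, VII 2.10] [cite: Clozel1990, §3.1]
[cite: FlathCorvallis1979, Thm. 3 and Thm. 4] -/
theorem stubF1aCM_of_hol
    (hhol : ∀ (L : Type) [Field L] [NumberField L] [IsCMField L] (ι : L →+* ℂ) (H : Matrix (Fin 3) (Fin 3) L) (T : GL (Fin 3) ℂ)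
      (hT : (T : Matrix (Fin 3) (Fin 3) ℂ)ᴴ * H.map ι * (T : Matrix (Fin 3) (Fin 3) ℂ) = Literature.Geometry.ComplexHyperbolic.BallModel.J)
      (μ : Measure (adelicGroupData (↥(maximalRealSubfield L)) L (IsCMField.complexConj L) 3 H).automorphicQuotient)
      [(adelicGroupData (↥(maximalRealSubfield L)) L (IsCMField.complexConj L) 3 H).IsAutomorphicMeasure μ]
      (P : DiscreteAutomorphicRep (adelicGroupData (↥(maximalRealSubfield L)) L (IsCMField.complexConj L) 3 H) μ),
      P.IsHolCotangentAt (cmArchSection L ι H T hT) (cmCompactFactor L ι H T hT) →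
      P.ArchIsotypy (uFormGroup (Fin 2) (Fin 1)) (cmArchSectionUForm L ι H T hT)) :
    ∀ (L : Type) [Field L] [NumberField L] [IsCMField L] (ι : L →+* ℂ) (H : Matrix (Fin 3) (Fin 3) L) (T : GL (Fin 3) ℂ)
      (hT : (T : Matrix (Fin 3) (Fin 3) ℂ)ᴴ * H.map ι * (T : Matrix (Fin 3) (Fin 3) ℂ) = Literature.Geometry.ComplexHyperbolic.BallModel.J)
      (μ : Measure (adelicGroupData (↥(maximalRealSubfield L)) L (IsCMField.complexConj L) 3 H).automorphicQuotient)
      [(adelicGroupData (↥(maximalRealSubfield L)) L (IsCMField.complexConj L) 3 H).IsAutomorphicMeasure μ]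
      (P : DiscreteAutomorphicRep (adelicGroupData (↥(maximalRealSubfield L)) L (IsCMField.complexConj L) 3 H) μ),
      (P.IsHolCotangentAt (cmArchSection L ι H T hT) (cmCompactFactor L ι H T hT) ∨
        P.IsAntiholCotangentAt (cmArchSection L ι H T hT) (cmCompactFactor L ι H T hT)) →
      P.ArchIsotypy (uFormGroup (Fin 2) (Fin 1)) (cmArchSectionUForm L ι H T hT) :=
  fun L _ _ _ ι H T hT μ _ P hP => archIsotypy_cm_of_hol_half L ι H T hT μ (fun P' hP' => hhol L ι H T hT μ P' hP') P hP

end CM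

end Summit.HodgeConjecture.HodgeConjecture.Cruxes.H413.F0P3ArchIsotypyConj
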